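import Summits.BirchSwinnertonDyer.Rank1Residual.Partition.MainConjecturesTamagawaJetchev
import Summits.BirchSwinnertonDyer.Rank1Residual.Partition.MainConjecturesCoveredAllPrimesPublished
import HarnessLib

/-!
# Rows C2, C16 and C3-ordinary FROM PUBLISHED NAMED FACTS with the Tamagawa proviso RELAXED: in rank
# one, `p ∤ ∏c_ℓ` OR (`E` optimal and at most one Tamagawa number divisible by `p`) — Jetchev 2008
# Cor. 1.5 in place of Kolyvagin's bound on the second locus (cell `b2b-bsdres`, GLUE seat gen 8;
# companion of `MainConjecturesTamagawaJetchev.lean` and `MainConjecturesCoveredAllPrimesPublished.lean`)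

HONEST FRAMING (cell `b2b-bsdres`, run/shared/lean/b2b/bsd-rank1-residual/, verbatim in every
file): the goal of the cell is to DELETE the COMBINATION-SHAPED residual classes of the
Birch–Swinnerton-Dyer formula for ALL analytic-rank `≤ 1` elliptic curves over `ℚ` — "full BSD
formula for every rank `≤ 1` curve in class `C`" assembled STRICTLY from published theorems — so
that the rank-`≤ 1` remainder becomes exactly the CONSTRUCTION-SHAPED classes, which are TYPED
(missing-input `Prop`s), NOT attempted. This is not "finishing BSD". Research routes; no claim
beyond the stated classes; nothing booked; no label changes. THEOREMS ONLY (no definition, no named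
fact, no `sorry`); every published theorem enters as one of the tree's existing named Literature
facts BY NAME; every unproved / untyped-in-Literature statement enters as an EXPLICIT binder.

## What this file records

Gen 7's row theorems `RowC2.bsdp_of_publishedFacts`, `RowC16.bsdp_of_publishedFacts`,
`RowC3.bsdp_of_publishedFacts_of_kobayashiMainConjecture` (every main-conjecture / control / link
input a named Literature fact) carry the Tamagawa proviso `htam0 : r = 1 → p ∤ ∏_ℓ c_ℓ(E)` (row C3: on
the ordinary branch), which is NOT a hypothesis of BCS Cor. 1.3.1 / Yan–Zhu Thm. 4.15 / JSW Thm. 1.2.1: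
it is where the tree's all-split STEP-L currency meets Kolyvagin's Tamagawa-blind upper bound
(module docstring of the companion). Here each row theorem is re-stated with `htam0` WEAKENED to the
pair of binders

* `hopt  : r = 1 → p ∣ ∏c_ℓ → (E carries an OPTIMAL parametrisation datum at level N_E)`
  (`∃ Dt : ModularParametrizationData W N_E, c·Λ_f = Λ_E` — Jetchev's setting: `E` is the
  `X₀(N)`-optimal curve of its isogeny class; `BSD(E,p)` is an isogeny invariant by Cassels, so the
  other curves of the class follow — `bsdp_of_isIsogenous_of_jetchevRow` in the capstone companion),
* `htam1 : r = 1 → p ∣ ∏c_ℓ → ∃ q ∣ N_E prime, ord_p ∏_ℓ c_ℓ(E) ≤ ord_p c_q(E)`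
  (the `p`-divisibility of the Tamagawa numbers is concentrated at ONE bad prime, i.e. at most one
  Tamagawa number of `E` is divisible by `p` — Jetchev's "In particular, if `p` divides at most one
  Tamagawa number, the above upper bound coincides with the exact upper bound … predicted by the Birch
  and Swinnerton-Dyer conjectural formula"),

both VACUOUS when `p ∤ ∏c_ℓ` (then gen 7's theorem is invoked verbatim) and otherwise feeding the
companion's `bsdp_rankOne_of_thm331_of_columnMainConjecture_odd_of_jetchev` (Jetchev 2008 Cor. 1.5 =
the named fact `Jetchev2008.cor15_padicValNat_card_primaryComponent_sha_le`, A27 PUB, binder `hJ`),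
with the anticyclotomic IMC ∘ BDP discharged exactly as in gen 7 (BCS 1.2.4 (b) ∘ CGLS 5.1.3 `h124`
for `p > 3`, Yan–Zhu 4.12 ∘ CGLS 5.1.3 `h412` at `p = 3`, through JSW 3.3.1 `h331` and the σ-bridge)
and (irred_𝒦) by `irrK_of_surj`. Rank `0` is untouched (no Tamagawa proviso there).

| theorem | row | residual typed input in rank one after this file |
|---|---|---|
| `RowC2.bsdp_of_publishedFacts_of_jetchev` | C2 (BCS Cor. 1.3.1) | `p ∣ ∏c_ℓ` ∧ (`E` not optimal ∨ `p ∣ c_ℓ` at ≥ 2 bad primes) |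
| `RowC16.bsdp_of_publishedFacts_of_jetchev` | C16 (Yan–Zhu Thm. 4.15, `p = 3`) | same |
| `RowC3.bsdp_of_publishedFacts_of_kobayashiMainConjecture_of_jetchev` | C3 (JSW Thm. 1.2.1), ordinary branch | same; supersingular branch: `hKMC` (unchanged) |

References: D. Jetchev, Compos. Math. 144 (2008), Hypothesis (∗), Cor. 1.5 (p. 3) [Jetchev2008];
Jetchev–Skinner–Wan 2017, §1 (p. 4), §7.4.2 (p. 31) [JetchevSkinnerWan2017]; Burungale–Castella–
Skinner 2025, Cor. 1.3.1 [BurungaleCastellaSkinner2025]; Yan–Zhu 2026, Thm. 4.15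
[YanZhu2024MainConjNonCM]; Miller 2011, Def. 1.1 [Miller2011LMS]; HOME/b2b-bsdres-lit-glue/GLUE.md
GEN 8 ADDENDUM.
-/

set_option autoImplicit false

noncomputable section

open scoped Classical

open CongruenceSubgroup WeierstrassCurve NumberField IsDedekindDomain
  Literature.NumberTheory.EllipticCurves Literature.NumberTheory.Automorphic
  Literature.NumberTheory.EllipticCurves.ModularForms
  Literature.NumberTheory.EllipticCurves.Rank1Residual
  Literature.NumberTheory.EllipticCurves.Rank1Residual.Typed
  Literature.NumberTheory.EllipticCurves.CastellaGrossiLeeSkinner2022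
  Literature.NumberTheory.EllipticCurves.BurungaleCastellaSkinner2025
  Literature.NumberTheory.EllipticCurves.YanZhu2026
  Literature.NumberTheory.EllipticCurves.BurungaleKobayashiOta2024
  Literature.NumberTheory.EllipticCurves.JetchevSkinnerWan2017
  Summit.BirchSwinnertonDyer.BirchSwinnertonDyer.Theorems.Rank1ResidualX1Defs

namespace Summit.BirchSwinnertonDyer.Rank1Residual

section Rows

variable (W : WeierstrassCurve ℚ) [W.IsElliptic] [W.IsGloballyMinimal] (p : ℕ) [Fact p.Prime]

/-- **Row C2 (`r ≤ 1`: `¬cm`, `p > 3` good ordinary, (irr), (im)) FROM PUBLISHED NAMED FACTS, Tamagawa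
proviso RELAXED.** Gen 7's `RowC2.bsdp_of_publishedFacts` off `p ∣ ∏c_ℓ`; on `r = 1 ∧ p ∣ ∏c_ℓ` with
`E` optimal (`hopt`) and the `p`-divisibility of the Tamagawa numbers at ONE bad prime (`htam1`):
Jetchev 2008 Cor. 1.5 (`hJ`) in place of Kolyvagin's bound — BCS 1.1.2 (b) for the twist (`hBCS`),
JSW 3.3.1 (`h331`), BCS 1.2.4 (b) ∘ CGLS 5.1.3 (`h124`), (irred_𝒦) ⇐ (sur), (im) ⇐ (sur) at `p ≥ 5`,
Gross–Zagier, Kolyvagin, Greenberg 4.1, GZK, modularity, Hoffstein–Luo, Mazur, Néron scaling. Rank `0`: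
BCS 1.1.2 (b) + Greenberg 4.1 (no proviso). [cite: Jetchev2008, Cor. 1.5 (p. 3)]
[cite: BurungaleCastellaSkinner2025, Thm. 1.1.2 (b), Thm. 1.2.4 (b), Cor. 1.3.1 and its proof (p. 4)]
[cite: JetchevSkinnerWan2017, Thm. 3.3.1, §7.4.2 (p. 31)] [cite: Miller2011LMS, Def. 1.1] -/
theorem RowC2.bsdp_of_publishedFacts_of_jetchev
    (hGZ : ∀ (N : ℕ) [NeZero N] (W : WeierstrassCurve ℚ) (K : Type) [Field K] [NumberField K],
      gross_zagier N W K)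
    (hKo : ∀ (N : ℕ) [NeZero N] (W : WeierstrassCurve ℚ) (K : Type) [Field K] [NumberField K],
      kolyvagin N W K)
    (hB : ∀ (N : ℕ) [NeZero N] (W : WeierstrassCurve ℚ) (K : Type) [Field K] [NumberField K],
      Kolyvagin1990_padicValNat_card_sha_le N W K)
    (hJ : Jetchev2008.cor15_padicValNat_card_primaryComponent_sha_le)
    (hBCS : thm112b_charIdeal_eq_padicLFunction_integral) (h331 : thm331_anticyclotomicControl)
    (h124 : thm124b_thm513_generator_constantCoeff)
    (hGr : greenberg_charValue_rankZero) (hGZK : rank_eq_analyticRank_of_analyticRank_le_one)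
    (hmod : hasEntireLFunction_rat) (hpar : nonempty_modularParametrizationData)
    (hnf : exists_isNewformOf) (hHL : HoffsteinLuo1997_exists_twist_L_one_ne_zero)
    (hMaz : mazur_not_dvd_maninConstant_of_odd) (hNS : integral_neronScaling_of_isGloballyMinimal)
    (h : RowC2 W p) (hr : W.analyticRank ≤ 1)
    (hopt : W.analyticRank = 1 → p ∣ W.tamagawaProduct → ∀ (N : ℕ) [NeZero N], W.conductorNorm ℤ = N →
      ∃ Dt : ModularParametrizationData W N,
        ∀ z ∈ Dt.L.lattice, ∃ w ∈ periodLattice Dt.f, z = (Dt.c : ℂ) * w)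
    (htam1 : W.analyticRank = 1 → p ∣ W.tamagawaProduct → ∃ (q : ℕ) (_ : Fact q.Prime),
      q ∣ W.conductorNorm ℤ ∧
      padicValNat p W.tamagawaProduct ≤ padicValNat p ((W.baseChange ℚ_[q]).localTamagawaNumber ℤ_[q])) :
    BSDp W p := by
  by_cases htp : p ∣ W.tamagawaProduct
  · have hp : 3 < p := h.2.1
    have hp5 : 5 ≤ p := (Fact.out : p.Prime).five_le_of_ne_two_of_ne_three (by omega) (by omega)
    have hsurj : Surj W p := surj_of_irr_of_bigIm W p h.2.2.2.1 h.2.2.2.2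
    rcases Nat.lt_or_ge W.analyticRank 1 with h0 | h1
    · exact RowC2.bsdp_rankZero_of_bcsThm112b hBCS hGr hpar hGZK h (by omega)
    · have hr1 : W.analyticRank = 1 := le_antisymm hr h1
      refine bsdp_rankOne_of_thm331_of_columnMainConjecture_odd_of_jetchev hGZ hKo hJ h331 hGr hGZK hmod
        hpar hnf hHL hMaz hNS W p (by omega) h.2.2.1 hsurj hr1 (hopt hr1 htp) (htam1 hr1 htp)
        (fun V _ _ hordV hirrV himV ↦ hBCS V p hp hordV hirrV himV)
        (fun V _ _ _ hsV ↦ X9.bigIm_of_surj V p hp5 hsV)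
        (fun K _ _ hK _ _ ↦ irrK_of_surj W p hsurj K hK.1) ?_
      intro N _ K _ _ Dt H ιC P hN hK hodd hlt hHN hHp _ hP hc hPinf κ hκ γ _ ι
      exact X11b.imcLowerWaldspurgerOnTreeGoodAt_inducedPlace_of_heegner_of_thm124b_of_thm331 W p N K
        Dt H ιC P h124 h331 (hKo N W K) hp h.2.2.1 hsurj (irrK_of_surj W p hsurj K hK.1) hN hK hodd hlt
        hHN hHp hP hc hPinf hκ ι
  · exact RowC2.bsdp_of_publishedFacts W p hGZ hKo hB hBCS h331 h124 hGr hGZK hmod hpar hnf hHL hMaz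
      hNS h hr fun _ ↦ htp

/-- **Row C16 (`r ≤ 1`: `p = 3` good ordinary, (irr), surj(3) ∨ ram(3)) FROM PUBLISHED NAMED FACTS,
Tamagawa proviso RELAXED.** Gen 7's `RowC16.bsdp_of_publishedFacts` off `3 ∣ ∏c_ℓ`; on
`r = 1 ∧ 3 ∣ ∏c_ℓ` with `E` optimal and ONE bad prime carrying the `3`-divisibility of the Tamagawa
numbers: Jetchev 2008 Cor. 1.5 (`hJ`; Hypothesis (∗) at `p = 3`: `3 ∤ N`, `ρ̄_{E,3}` onto — ram(3) ⇒
surj(3) by `surj_of_irr_of_ram`) in place of Kolyvagin's bound — Yan–Zhu 4.9 for the twist (`hYZ`),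
JSW 3.3.1 at `p = 3` (`h331`), Yan–Zhu 4.12 ∘ CGLS 5.1.3 (`h412`), (Im) at `3` ⇐ surj(3) (Wuthrich
L. 20 `hW20`), (irred_𝒦) ⇐ (sur), and the cited control. [cite: Jetchev2008, Cor. 1.5 (p. 3)]
[cite: YanZhu2024MainConjNonCM, Thm. 4.9, Thm. 4.12, Thm. 4.15 and its proof (§4.6)]
[cite: JetchevSkinnerWan2017, Thm. 3.3.1, §7.4.2 (p. 31)] [cite: Wuthrich2014, Lemma 20 (p. 399)]
[cite: Miller2011LMS, Def. 1.1] -/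
theorem RowC16.bsdp_of_publishedFacts_of_jetchev
    (hGZ : ∀ (N : ℕ) [NeZero N] (W : WeierstrassCurve ℚ) (K : Type) [Field K] [NumberField K],
      gross_zagier N W K)
    (hKo : ∀ (N : ℕ) [NeZero N] (W : WeierstrassCurve ℚ) (K : Type) [Field K] [NumberField K],
      kolyvagin N W K)
    (hB : ∀ (N : ℕ) [NeZero N] (W : WeierstrassCurve ℚ) (K : Type) [Field K] [NumberField K],
      Kolyvagin1990_padicValNat_card_sha_le N W K)
    (hJ : Jetchev2008.cor15_padicValNat_card_primaryComponent_sha_le)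
    (hYZ : thm49_charIdeal_eq_padicLFunction_integral)
    (hW20 : Wuthrich2014.lemma20_surjective_threeAdic_of_semistable)
    (h331 : thm331_anticyclotomicControl) (h412 : thm412_thm513_generator_constantCoeff)
    (hGr : greenberg_charValue_rankZero) (hGZK : rank_eq_analyticRank_of_analyticRank_le_one)
    (hmod : hasEntireLFunction_rat) (hpar : nonempty_modularParametrizationData)
    (hnf : exists_isNewformOf) (hHL : HoffsteinLuo1997_exists_twist_L_one_ne_zero)
    (hMaz : mazur_not_dvd_maninConstant_of_odd) (hNS : integral_neronScaling_of_isGloballyMinimal)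
    (h : RowC16 W p) (hr : W.analyticRank ≤ 1)
    (hopt : W.analyticRank = 1 → p ∣ W.tamagawaProduct → ∀ (N : ℕ) [NeZero N], W.conductorNorm ℤ = N →
      ∃ Dt : ModularParametrizationData W N,
        ∀ z ∈ Dt.L.lattice, ∃ w ∈ periodLattice Dt.f, z = (Dt.c : ℂ) * w)
    (htam1 : W.analyticRank = 1 → p ∣ W.tamagawaProduct → ∃ (q : ℕ) (_ : Fact q.Prime),
      q ∣ W.conductorNorm ℤ ∧
      padicValNat p W.tamagawaProduct ≤ padicValNat p ((W.baseChange ℚ_[q]).localTamagawaNumber ℤ_[q])) :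
    BSDp W p := by
  by_cases htp : p ∣ W.tamagawaProduct
  · rcases Nat.lt_or_ge W.analyticRank 1 with h0 | h1
    · exact RowC16.bsdp_rankZero_of_yzThm49 hYZ hW20 hGr hpar hGZK h (by omega)
    · have hr1 : W.analyticRank = 1 := le_antisymm hr h1
      have hopt1 := hopt hr1 htp
      have htam11 := htam1 hr1 htp
      obtain ⟨hp3, hord, hirr, hsr⟩ := h
      have hsurj : Surj W p := hsr.elim id fun hram ↦ surj_of_irr_of_ram W p hirr hram
      subst hp3
      have him : BigIm W 3 := X9.bigIm_three_of_surj W hW20 (Or.inl hord.1) hsurj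
      refine bsdp_rankOne_of_thm331_of_columnMainConjecture_odd_of_jetchev hGZ hKo hJ h331 hGr hGZK hmod
        hpar hnf hHL hMaz hNS W 3 le_rfl hord hsurj hr1 hopt1 htam11
        (fun V _ _ hordV hirrV himV ↦ hYZ V 3 le_rfl hordV hirrV himV)
        (fun V _ _ hordV hsV ↦ X9.bigIm_three_of_surj V hW20 (Or.inl hordV.1) hsV)
        (fun K _ _ hK _ _ ↦ irrK_of_surj W 3 hsurj K hK.1) ?_
      intro N _ K _ _ Dt H ιC P hN hK hodd hlt hHN hHp _ hP hc hPinf κ hκ γ _ ι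
      exact X11b.imcLowerWaldspurgerOnTreeGoodAt_inducedPlace_of_heegner_of_thm412_of_thm331 W 3 N K
        Dt H ιC P h412 h331 (hKo N W K) le_rfl hord him (irrK_of_surj W 3 hsurj K hK.1) hN hK hodd hlt
        hHN hHp hP hc hPinf hκ ι
  · exact RowC16.bsdp_of_publishedFacts W p hGZ hKo hB hYZ hW20 h331 h412 hGr hGZK hmod hpar hnf hHL
      hMaz hNS h hr fun _ ↦ htp

/-- **Row C3 (= JSW 2017 Thm. 1.2.1) at every prime of the row FROM PUBLISHED NAMED FACTS on the
ordinary branch, Tamagawa proviso RELAXED.** Gen 7's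
`RowC3.bsdp_of_publishedFacts_of_kobayashiMainConjecture` off `GoodOrd ∧ p ∣ ∏c_ℓ`; on that locus with
`E` optimal and ONE bad prime carrying the `p`-divisibility of the Tamagawa numbers: Jetchev 2008
Cor. 1.5 (`hJ`; (sur) from Diamond's refined Serre `RowC3.surj`) in place of Kolyvagin's bound — the
column's published cyclotomic MC (BCS (b) `hBCS` for `p ≥ 5`, Yan–Zhu 4.9 `hYZ` at `p = 3`), JSW
3.3.1 (`h331`), the anticyclotomic IMC ∘ BDP (BCS 1.2.4 (b) ∘ CGLS 5.1.3 `h124` for `p ≥ 5`, Yan–Zhu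
4.12 ∘ CGLS 5.1.3 `h412` at `p = 3`), (Im) at `3` (Wuthrich L. 20), (irred_𝒦) ⇐ (sur), cited control.
Supersingular branch unchanged: Kobayashi's signed main conjecture (`hKMC`, OPEN in print off CM /
`a_p = 0`) + BKO 2024 Cor. A.5 — no Tamagawa proviso there. This is JSW's §7.4 with §7.4.2's `K″`
replaced, on the one-Tamagawa-prime locus, by Jetchev's classical-parametrisation bound (JSW p. 4).
[cite: Jetchev2008, Cor. 1.5 (p. 3)] [cite: JetchevSkinnerWan2017, Thm. 1.2.1, Thm. 3.3.1, §1 (p. 4), §7.4.1–7.4.2 (pp. 30–31)]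
[cite: BurungaleCastellaSkinner2025, Thm. 1.1.2 (b), Thm. 1.2.4 (b)] [cite: YanZhu2024MainConjNonCM, Thm. 4.9, Thm. 4.12]
[cite: BurungaleKobayashiOta2023, App. A Cor. A.5] [cite: Miller2011LMS, Def. 1.1] -/
theorem RowC3.bsdp_of_publishedFacts_of_kobayashiMainConjecture_of_jetchev
    (hGZ : ∀ (N : ℕ) [NeZero N] (W : WeierstrassCurve ℚ) (K : Type) [Field K] [NumberField K],
      gross_zagier N W K)
    (hKo : ∀ (N : ℕ) [NeZero N] (W : WeierstrassCurve ℚ) (K : Type) [Field K] [NumberField K],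
      kolyvagin N W K)
    (hB : ∀ (N : ℕ) [NeZero N] (W : WeierstrassCurve ℚ) (K : Type) [Field K] [NumberField K],
      Kolyvagin1990_padicValNat_card_sha_le N W K)
    (hJ : Jetchev2008.cor15_padicValNat_card_primaryComponent_sha_le)
    (hBCS : thm112b_charIdeal_eq_padicLFunction_integral)
    (hYZ : thm49_charIdeal_eq_padicLFunction_integral)
    (hW20 : Wuthrich2014.lemma20_surjective_threeAdic_of_semistable)
    (h331 : thm331_anticyclotomicControl) (h124 : thm124b_thm513_generator_constantCoeff)
    (h412 : thm412_thm513_generator_constantCoeff)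
    (hA5 : corA5_pPart_of_signedCharIdeal_eq)
    (hGr : greenberg_charValue_rankZero) (hGZK : rank_eq_analyticRank_of_analyticRank_le_one)
    (hmod : hasEntireLFunction_rat) (hpar : nonempty_modularParametrizationData)
    (hnf : exists_isNewformOf) (hLL : diamond1995_refinedSerre)
    (hHL : HoffsteinLuo1997_exists_twist_L_one_ne_zero)
    (hMaz : mazur_not_dvd_maninConstant_of_odd) (hNS : integral_neronScaling_of_isGloballyMinimal)
    (h : RowC3 W p)
    (hopt : GoodOrd W p → p ∣ W.tamagawaProduct → ∀ (N : ℕ) [NeZero N], W.conductorNorm ℤ = N →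
      ∃ Dt : ModularParametrizationData W N,
        ∀ z ∈ Dt.L.lattice, ∃ w ∈ periodLattice Dt.f, z = (Dt.c : ℂ) * w)
    (htam1 : GoodOrd W p → p ∣ W.tamagawaProduct → ∃ (q : ℕ) (_ : Fact q.Prime),
      q ∣ W.conductorNorm ℤ ∧
      padicValNat p W.tamagawaProduct ≤ padicValNat p ((W.baseChange ℚ_[q]).localTamagawaNumber ℤ_[q]))
    (ε : ℤˣ) (hKMC : (p : ℤ) ∣ W.frobeniusTrace p → Supersingular.KobayashiMainConjecture W p ε) :
    BSDp W p := by
  by_cases hJet : GoodOrd W p ∧ p ∣ W.tamagawaProduct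
  · obtain ⟨hord, htp⟩ := hJet
    have hsurj : Surj W p := RowC3.surj hnf hLL h
    have hp : 5 ≤ p ∨ p = 3 ∧ (GoodOrd W p ∨ W.frobeniusTrace 3 = 0) := h.2.2.2.2
    have hp3 : 3 ≤ p := by rcases hp with h5 | ⟨h3, -⟩ <;> omega
    refine bsdp_rankOne_of_thm331_of_columnMainConjecture_odd_of_jetchev hGZ hKo hJ h331 hGr hGZK hmod
      hpar hnf hHL hMaz hNS W p hp3 hord hsurj h.1 (hopt hord htp) (htam1 hord htp) ?_ ?_
      (fun K _ _ hK _ _ ↦ irrK_of_surj W p hsurj K hK.1) ?_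
    · intro V _ _ hordV hirrV himV
      by_cases h5 : 5 ≤ p
      · exact hBCS V p (by omega) hordV hirrV himV
      · have h3 : p = 3 := by rcases hp with h | ⟨h, -⟩ <;> omega
        subst h3
        exact hYZ V 3 le_rfl hordV hirrV himV
    · intro V _ _ hordV hsV
      by_cases h5 : 5 ≤ p
      · exact X9.bigIm_of_surj V p h5 hsV
      · have h3 : p = 3 := by rcases hp with h | ⟨h, -⟩ <;> omega
        subst h3
        exact X9.bigIm_three_of_surj V hW20 (Or.inl hordV.1) hsV
    · intro N _ K _ _ Dt H ιC P hN hK hodd hlt hHN hHp _ hP hc hPinf κ hκ γ _ ι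
      by_cases h5 : 5 ≤ p
      · exact X11b.imcLowerWaldspurgerOnTreeGoodAt_inducedPlace_of_heegner_of_thm124b_of_thm331 W p N K
          Dt H ιC P h124 h331 (hKo N W K) (by omega) hord hsurj (irrK_of_surj W p hsurj K hK.1) hN hK
          hodd hlt hHN hHp hP hc hPinf hκ ι
      · have h3 : p = 3 := by rcases hp with h | ⟨h, -⟩ <;> omega
        subst h3
        exact X11b.imcLowerWaldspurgerOnTreeGoodAt_inducedPlace_of_heegner_of_thm412_of_thm331 W 3 N K
          Dt H ιC P h412 h331 (hKo N W K) le_rfl hord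
          (X9.bigIm_three_of_surj W hW20 (Or.inl hord.1) hsurj) (irrK_of_surj W 3 hsurj K hK.1) hN hK
          hodd hlt hHN hHp hP hc hPinf hκ ι
  · exact RowC3.bsdp_of_publishedFacts_of_kobayashiMainConjecture W p hGZ hKo hB hBCS hYZ hW20 h331
      h124 h412 hA5 hGr hGZK hmod hpar hnf hLL hHL hMaz hNS h (fun hord htp ↦ hJet ⟨hord, htp⟩) ε hKMC

end Rows

end Summit.BirchSwinnertonDyer.Rank1Residual

end
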